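import Summits.BirchSwinnertonDyer.BirchSwinnertonDyer.Theorems.ResidualThetaTransportAtTwoRelativeLubinTateBase
import Literature.NumberTheory.GaloisRepresentations.LubinTatePoints
import HarnessLib

/-!
# The formal group of a supersingular model with `a_p = 0` is RELATIVE LUBIN–TATE for `(π, q) = (−p, p²)`, IV:
# POINTS — on every closed nil ideal `𝔪` of a complete linearly topologised `A`-algebra, the curve's formal-group points `Ê(𝔪)`
# ARE Lubin–Tate's `A`-module `F_f(𝔪)` (`[a]·x`, `a ∈ A`), with `[n]·x = [n]_E(x)`, `[−p]·x = f(x)`, and `A`-algebra automorphisms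
# acting `A`-linearly — at `p = 2`: `Ê(𝔪_{k'})` is a `ℤ₄`-module for every complete `k' ⊇ ℚ₄` (kernel)

Route `ResidualThetaTransportAtTwo` (RTT), crux (R≥)ᵖ `ResidualThetaCountLowerPureAtTwo` (stmt-BirchSwinnertonDyer-26074); seat
`prover-bsd-wall-rtt-p2` g9 (`--supports`, closes nothing); memo `Cruxes/ResidualThetaCountLowerPureAtTwo/RELATIVE-LT-g9.md` §2(a).
Sequel of `…RelativeLubinTateSeries` (p608987), `…Module` (p609616), `…Base`. HONEST FRAMING: THEOREMS ONLY (no definition, no named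
fact, no instance, no `sorry`); route-independent; nothing about any Selmer group; BSD is not proved by any of this.

WHY. (UQ2) of `RMC-ROADS-g6.md` §1 — descent of Kobayashi's `+` condition along `k' = ℚ₄·k_n / k_n` — needs the `ℤ₄`-module structure
on the POINTS `Ê(𝔪_{k'})` (and then on `E⁺(k')`), Frobenius-semilinear, after which `…SemilinearDescent` (`M = M^φ ⊕ ωM^φ`,
`H¹ = Ĥ⁰ = 0`) finishes the descent. The tree's Lubin–Tate POINTS library (`Literature…LubinTatePoints`: `NilIdeal`, `evalPt`,
`ltAdd`, `ltSMul` with the module laws `ltSMul_ltAdd`, `add_ltSMul`, `mul_ltSMul`, `one_ltSMul`, Cassels–Fröhlich VI §3.2–3.4) is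
written for `LubinTate.formalGroup hA hf`; part III proved `F_U = LubinTate.ltF hA hf_U`. This file transports: the Lubin–Tate point
operations ARE the curve's.

WHAT (`A` a discretely uniformised commutative ring with `hA : IsLTRing (−p) (p²)`; `S` a complete Hausdorff linearly topologised
`A`-algebra, `𝔪` a `LubinTate.NilIdeal S`; `U/A` a Weierstrass model with `hU : p ∣ [Xⁿ] i([p]X) − δ_{n,p²}`, `f := i([p]X)`):
* `ltAdd_eq_evalPt_formalGroupLaw` — `x ⊕ y = F_U(x, y)`: Lubin–Tate addition on `𝔪` is the curve's formal group law evaluated;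
* `ltSMul_natCast_eq_evalPt₁_formalMul` — `[n]·x = [n]_U(x)` (the curve's multiplication series evaluated); `ltSMul_neg_eq_evalPt₁`
  — `[−p]·x = f(x) = i([p] x)`;
* `points_module_laws` — `[a](x ⊕ y) = [a]x ⊕ [a]y`, `[a+b]x = [a]x ⊕ [b]x`, `[ab]x = [a]([b]x)`, `[1]x = x` (the library's laws, by name,
  for THIS `f`): `Ê(𝔪)` is an `A`-module extending its `ℤ`-structure;
* `algHom_ltSMul` — every continuous `A`-algebra endomorphism `σ` of `S` preserving `𝔪` commutes with every `[a]` (coefficients in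
  `A`): `σ([a]x) = [a](σx)`. (For a `σ` acting on `A` through a ring endomorphism `τ` — Frobenius of `ℤ₄` — combine with part II's
  series identity `map_hom_eq_hom_apply : [a]^τ = [τ a]` to get `σ([a]x) = [τa](σx)`; not spelled out here.)
What is NOT here (next brick, carrier-level): the dictionary `𝔪_{k'} ↔ E₁(k')` of the tree's `FormalGroupChart`/`BallEval` (`zCoord`,
`ptOf`, `zCoord_add_eq_evF`) for `k' ⊇ ℚ₄` inside `PadicAlgCl 2`, and a concrete `ℤ₄` (`𝒪[ℚ_[2]⟮ζ₃⟯]` or `𝕎(𝔽₄)`) with its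
`IsLTRing (−2) 4` (part I `isLTRing_of_isLocalRing` reduces it to `a⁴ ≡ a (mod 2)`).

References: [CasselsFrohlichANT1967] Ch. VI §3.2 (`F(𝔪_L)`), §3.4 (the `A`-module `M_f`); [LubinTate1965] §1 Thm. 1 (8)–(11), §2;
[Kobayashi2003] Prop. 8.6, §8.4; [deShalit1987] Ch. I §1.
-/

set_option autoImplicit false
-- the Theorems namespace of this sub repeats the summit name by design (D-0017 nested layout)
set_option linter.dupNamespace false

noncomputable section

open scoped Classical
open PowerSeries WeierstrassCurve Literature.NumberTheory.EllipticCurves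
  Literature.NumberTheory.GaloisRepresentations

namespace Summit.BirchSwinnertonDyer.BirchSwinnertonDyer.Theorems.RelativeLubinTate

section Points

variable {p : ℕ} {A : Type*} [CommRing A] [UniformSpace A] [DiscreteUniformity A]
  {S : Type*} [CommRing S] [UniformSpace S] [IsUniformAddGroup S] [IsTopologicalRing S]
  [IsLinearTopology S S] [T2Space S] [CompleteSpace S] [Algebra A S] [ContinuousSMul A S]
  (𝔪 : LubinTate.NilIdeal S) (U : WeierstrassCurve A) (hA : LubinTate.IsLTRing (-(p : A)) (p ^ 2))
  (hU : ∀ n : ℕ, (p : A) ∣ coeff n (U.formalNeg.subst (U.formalMul p)) - (if n = p ^ 2 then 1 else 0))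

/-- **Lubin–Tate addition on `𝔪` is the curve's formal group law**: `x ⊕ y = F_U(x, y)` for the Lubin–Tate group of
`f = i([p]X)` (part III `formalGroupLaw_eq_ltF'`). [cite: CasselsFrohlichANT1967, Ch. VI §3.2] -/
theorem ltAdd_eq_evalPt_formalGroupLaw (x y : 𝔪.toIdeal) :
    LubinTate.ltAdd 𝔪 hA (isLTSeries_of_dvd U hU) x y =
      LubinTate.evalPt 𝔪 U.formalGroupLaw U.constantCoeff_formalGroupLaw ![x, y] := by
  unfold LubinTate.ltAdd LubinTate.addPt
  exact LubinTate.evalPt_congr 𝔪 (by rw [LubinTate.formalGroup_toPowerSeries]; exact (formalGroupLaw_eq_ltF' U hA hU).symm) _ _ _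

/-- **`[n]·x = [n]_U(x)`**: the Lubin–Tate scalar `n ∈ ℕ ⊆ A` acts by the curve's own multiplication series (part III
`formalMul_eq_hom'`). [cite: LubinTate1965, §1 Lemma 1] -/
theorem ltSMul_natCast_eq_evalPt₁_formalMul (n : ℕ) (x : 𝔪.toIdeal) :
    LubinTate.ltSMul 𝔪 hA (isLTSeries_of_dvd U hU) (n : A) x =
      LubinTate.evalPt₁ 𝔪 (U.formalMul n) (U.constantCoeff_formalMul n) x := by
  unfold LubinTate.ltSMul LubinTate.evalPt₁
  exact LubinTate.evalPt_congr 𝔪 (formalMul_eq_hom' U hA hU n).symm _ _ _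

/-- **`[−p]·x = f(x) = i_U([p]_U x)`** on points (Lubin–Tate's `[π]_f = f`). [cite: LubinTate1965, §1 Thm. 1 (11)] -/
theorem ltSMul_neg_eq_evalPt₁ (x : 𝔪.toIdeal) :
    LubinTate.ltSMul 𝔪 hA (isLTSeries_of_dvd U hU) (-(p : A)) x =
      LubinTate.evalPt₁ 𝔪 (U.formalNeg.subst (U.formalMul p)) (constantCoeff_formalNeg_subst_formalMul' U p) x := by
  unfold LubinTate.ltSMul LubinTate.evalPt₁
  exact LubinTate.evalPt_congr 𝔪 (LubinTate.hom_self_eq hA (isLTSeries_of_dvd U hU)) _ _ _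

/-- **`Ê(𝔪)` is an `A`-module**: with `x ⊕ y = F_U(x,y)` and `a·x = [a](x)`: `[a](x ⊕ y) = [a]x ⊕ [a]y`, `[a+b]x = [a]x ⊕ [b]x`,
`[ab]x = [a]([b]x)`, `[1]x = x`, `[0]x = 0`, `x ⊕ 0 = x` — the tree's Lubin–Tate point laws, valid for the curve's `f = i([p]X)`.
At `p = 2`, `A = ℤ₄`: `Ê(𝔪_{k'})` is a `ℤ₄`-module for every complete `k' ⊇ ℚ₄`. [cite: CasselsFrohlichANT1967, Ch. VI §3.4]
[cite: LubinTate1965, §1 Thm. 1 (8)–(11)] -/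
theorem points_module_laws (a b : A) (x y : 𝔪.toIdeal) :
    LubinTate.ltSMul 𝔪 hA (isLTSeries_of_dvd U hU) a (LubinTate.ltAdd 𝔪 hA (isLTSeries_of_dvd U hU) x y) =
        LubinTate.ltAdd 𝔪 hA (isLTSeries_of_dvd U hU) (LubinTate.ltSMul 𝔪 hA (isLTSeries_of_dvd U hU) a x)
          (LubinTate.ltSMul 𝔪 hA (isLTSeries_of_dvd U hU) a y) ∧
      LubinTate.ltSMul 𝔪 hA (isLTSeries_of_dvd U hU) (a + b) x =
        LubinTate.ltAdd 𝔪 hA (isLTSeries_of_dvd U hU) (LubinTate.ltSMul 𝔪 hA (isLTSeries_of_dvd U hU) a x)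
          (LubinTate.ltSMul 𝔪 hA (isLTSeries_of_dvd U hU) b x) ∧
      LubinTate.ltSMul 𝔪 hA (isLTSeries_of_dvd U hU) (a * b) x =
        LubinTate.ltSMul 𝔪 hA (isLTSeries_of_dvd U hU) a (LubinTate.ltSMul 𝔪 hA (isLTSeries_of_dvd U hU) b x) ∧
      LubinTate.ltSMul 𝔪 hA (isLTSeries_of_dvd U hU) 1 x = x ∧
      LubinTate.ltSMul 𝔪 hA (isLTSeries_of_dvd U hU) 0 x = 0 ∧
      LubinTate.ltAdd 𝔪 hA (isLTSeries_of_dvd U hU) x 0 = x :=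
  ⟨LubinTate.ltSMul_ltAdd 𝔪 hA _ a x y, LubinTate.add_ltSMul 𝔪 hA _ a b x, LubinTate.mul_ltSMul 𝔪 hA _ a b x,
    LubinTate.one_ltSMul 𝔪 hA _ x, LubinTate.zero_ltSMul 𝔪 hA _ x, LubinTate.ltAdd_zero 𝔪 hA _ x⟩

/-- **`A`-algebra automorphisms act `A`-linearly on `Ê(𝔪)`**: a continuous `A`-algebra endomorphism `σ` of `S` preserving `𝔪`
commutes with every `[a]` (`a ∈ A`; the coefficients of `[a]` lie in `A`). For `Gal(k'/ℚ₄)` acting on `Ê(𝔪_{k'})` this is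
`ℤ₄`-linearity; the Frobenius of `ℤ₄` acts semilinearly via part II's `map_hom_eq_hom_apply`.
[cite: CasselsFrohlichANT1967, Ch. VI §3.6 Prop. 6 (b) (proof)] -/
theorem algHom_ltSMul (σ : S →ₐ[A] S) (hσ : Continuous σ) (a : A) (x : 𝔪.toIdeal) (hx : σ x ∈ 𝔪.toIdeal) :
    (σ (LubinTate.ltSMul 𝔪 hA (isLTSeries_of_dvd U hU) a x) : S) =
      (LubinTate.ltSMul 𝔪 hA (isLTSeries_of_dvd U hU) a ⟨σ x, hx⟩ : S) := by
  unfold LubinTate.ltSMul LubinTate.evalPt₁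
  rw [LubinTate.coe_evalPt, LubinTate.coe_evalPt, ← AlgHom.comp_apply, MvPowerSeries.comp_aeval _ hσ]

/-- Likewise for the formal-group sum: `σ(x ⊕ y) = σx ⊕ σy`. [cite: CasselsFrohlichANT1967, Ch. VI §3.2] -/
theorem algHom_ltAdd (σ : S →ₐ[A] S) (hσ : Continuous σ) (x y : 𝔪.toIdeal) (hx : σ x ∈ 𝔪.toIdeal)
    (hy : σ y ∈ 𝔪.toIdeal) :
    (σ (LubinTate.ltAdd 𝔪 hA (isLTSeries_of_dvd U hU) x y) : S) =
      (LubinTate.ltAdd 𝔪 hA (isLTSeries_of_dvd U hU) ⟨σ x, hx⟩ ⟨σ y, hy⟩ : S) := by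
  unfold LubinTate.ltAdd LubinTate.addPt
  rw [LubinTate.coe_evalPt, LubinTate.coe_evalPt, ← AlgHom.comp_apply, MvPowerSeries.comp_aeval _ hσ]
  have key : ∀ (F : MvPowerSeries (Fin 2) A) (g₁ g₂ : Fin 2 → S) (h₁ : MvPowerSeries.HasEval g₁)
      (h₂ : MvPowerSeries.HasEval g₂), g₁ = g₂ → MvPowerSeries.aeval h₁ F = MvPowerSeries.aeval h₂ F := by
    rintro F g₁ g₂ h₁ h₂ rfl; rfl
  exact key _ _ _ _ _ (funext fun i ↦ by fin_cases i <;> rfl)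

end Points

end Summit.BirchSwinnertonDyer.BirchSwinnertonDyer.Theorems.RelativeLubinTate

end
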